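import Summits.AtomisticToContinuum.HydrodynamicLimit.Theorems.AntiMazurCoboundariesKineticFluxLdDecayCutProductionLeMoment
import HarnessLib

/-!
# Continuity of the cut Hellinger production at the local Maxwellian — preliminaries (helper file 1 of 2 of the
# registered stub `stub_productionContinuity`; crux `KineticFluxLdDecay`, stmt-AtomisticToContinuum-10967)

Fibrewise lemmas, in the frame of `Theorems/…HTheoremObjects.lean` and with the architecture of the landed
`Theorems/…CutProductionLeMoment.lean` (everything `ℝ≥0∞`-valued, no integrability side conditions), for one velocity
density `g` (`ℝ≥0∞`-valued w.r.t. `γ`, entering the defect through `(g ·).toReal`) and a centring constant `c ≥ 0`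
(later `c² = n(x) = ∫ g dγ`), `ζ = √g - c`:
* `lintegral_loss_le₂(_gauss)` — the ASYMMETRIC loss bound
  `∫ B M M_* a(v) b(v_*) ≤ |S²| [(∫ ‖w‖ a dγ)(∫ b dγ) + (∫ a dγ)(∫ ‖w‖ b dγ)]` (`B ≤ ‖v‖ + ‖v_*‖`, Tonelli);
* `fibre_le` — `∫ B M M_* Ξ(g)² ≤ 8|S²| [(∫ g dγ + c²) ∫ ‖w‖ ζ² dγ + (∫ ζ² dγ)(∫ ‖w‖ g dγ + c² ∫ ‖w‖ dγ)]`: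
  `Ξ² ≤ 2(√(g'g'_*) - c²)² + 2(√(g g_*) - c²)²`, the gain half equals the loss half by the collision involution
  `(v, v_*, ω) ↦ (v', v_*', -ω)` (`lintegral_collisionDensity_mul_comp_collide_negDir`), and
  `(√(g g_*) - c²)² ≤ 2 ζ² g_* + 2 c² ζ_*²`;
* the velocity truncations `∫ ζ² ≤ ∫ g + c²`, `∫ ‖w‖ g ≤ R ∫ g + R⁻¹ ∫ ‖w‖² g`,
  `∫ ‖w‖ ζ² ≤ R ∫ ζ² + R⁻¹ (∫ ‖w‖² g + c² ∫ ‖w‖² dγ)`;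
* the registered helper stub `stub_productionContinuityPrelim : ProductionContinuityPrelim` — the KEPT-FIBRE BOUND
  that file 2 (`…ProductionContinuity.lean`) integrates in `x`: if `∫ g dγ ≤ K` and `c² ≤ K` then
  `∫ B M M_* Ξ(g)² ≤ 8|S²| K [(3R + m_γ) ∫ ζ² dγ + R⁻¹ (4 ∫ ‖w‖² g dγ + 2 K m₂,γ)]` for every `R > 0`.

Reference: C. Cercignani, R. Illner, M. Pulvirenti, *The Mathematical Theory of Dilute Gases* (1994), §3.1.
-/

noncomputable section

open MeasureTheory ProbabilityTheory Set Filter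
open scoped ENNReal

namespace Summit.AtomisticToContinuum.HydrodynamicLimit.Theorems.HTheorem

open Literature.MathematicalPhysics.KineticTheory (V3 collide sphereMeasure)
open Literature.Analysis.FluidPDE (globalMaxwellian continuous_globalMaxwellian isFiniteMeasure_sphereMeasure
  stdGaussian_eq_withDensity_globalMaxwellian_holds)
open Literature.Analysis.UnboundedOperators (collisionDensity collisionDensity_nonneg
  measurable_collisionDensity)

namespace CutProductionContinuity

/-! ### Pointwise real inequalities -/

/-- `(√a √b - c²)² ≤ 2 (√a - c)² b + 2 c² (√b - c)²` for `b ≥ 0` (write `√a = c + ζ`, `√b = c + ζ_*`: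
`√a √b - c² = ζ √b + c ζ_*`). -/
theorem sq_sqrt_mul_sqrt_sub_sq_le (a : ℝ) {b : ℝ} (hb : 0 ≤ b) (c : ℝ) :
    (Real.sqrt a * Real.sqrt b - c ^ 2) ^ 2 ≤
      2 * ((Real.sqrt a - c) ^ 2 * b) + 2 * (c ^ 2 * (Real.sqrt b - c) ^ 2) := by
  have hb' : Real.sqrt b ^ 2 = b := Real.sq_sqrt hb
  have hid : Real.sqrt a * Real.sqrt b - c ^ 2 =
      (Real.sqrt a - c) * Real.sqrt b + c * (Real.sqrt b - c) := by ring
  rw [hid]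
  calc ((Real.sqrt a - c) * Real.sqrt b + c * (Real.sqrt b - c)) ^ 2
      ≤ 2 * ((Real.sqrt a - c) * Real.sqrt b) ^ 2 + 2 * (c * (Real.sqrt b - c)) ^ 2 := by
        nlinarith [sq_nonneg ((Real.sqrt a - c) * Real.sqrt b - c * (Real.sqrt b - c))]
    _ = _ := by rw [mul_pow, mul_pow, hb']

/-- `(√a - c)² ≤ a + c²` for `a ≥ 0`, `c ≥ 0`. -/
theorem sq_sqrt_sub_le {a c : ℝ} (ha : 0 ≤ a) (hc : 0 ≤ c) : (Real.sqrt a - c) ^ 2 ≤ a + c ^ 2 := by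
  have h1 : Real.sqrt a ^ 2 = a := Real.sq_sqrt ha
  nlinarith [Real.sqrt_nonneg a, mul_nonneg (Real.sqrt_nonneg a) hc]

/-- `t ≤ R + t²/R` for `R > 0`. -/
theorem le_add_sq_div (t : ℝ) {R : ℝ} (hR : 0 < R) : t ≤ R + t ^ 2 / R := by
  have h2 : R + t ^ 2 / R - t = ((t - R / 2) ^ 2 + 3 * R ^ 2 / 4) / R := by
    field_simp
    ring
  exact sub_nonneg.1 (h2 ▸ by positivity)

/-! ### The asymmetric loss bound -/

/-- **Asymmetric loss bound** (Tonelli; `B M M_* ≤ (‖v‖ + ‖v_*‖) M M_*`, `|S²| < ∞`):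
`∫ B M M_* a(v) b(v_*) dv dv_* dω ≤ |S²| [(∫ ‖v‖ M a)(∫ M b) + (∫ M a)(∫ ‖v‖ M b)]`. -/
theorem lintegral_loss_le₂ {a b : V3 → ℝ≥0∞} (ha : Measurable a) (hb : Measurable b) :
    ∫⁻ q, ENNReal.ofReal (collisionDensity q) * (a q.1.1 * b q.1.2) ∂collMeasure ≤
      sphereMeasure (Set.univ : Set (Metric.sphere (0 : V3) 1)) *
        ((∫⁻ v, ‖v‖ₑ * (ENNReal.ofReal (globalMaxwellian v) * a v)) *
            (∫⁻ v, ENNReal.ofReal (globalMaxwellian v) * b v) +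
          (∫⁻ v, ENNReal.ofReal (globalMaxwellian v) * a v) *
            ∫⁻ v, ‖v‖ₑ * (ENNReal.ofReal (globalMaxwellian v) * b v)) := by
  haveI := isFiniteMeasure_sphereMeasure (E := V3)
  have hMm : Measurable fun v : V3 => ENNReal.ofReal (globalMaxwellian v) :=
    continuous_globalMaxwellian.measurable.ennreal_ofReal
  set A : V3 → ℝ≥0∞ := fun v => ENNReal.ofReal (globalMaxwellian v) * a v with hA
  set B : V3 → ℝ≥0∞ := fun v => ENNReal.ofReal (globalMaxwellian v) * b v with hB
  have hAm : Measurable A := hMm.mul ha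
  have hBm : Measurable B := hMm.mul hb
  have hA1 : Measurable fun v : V3 => ‖v‖ₑ * A v := measurable_enorm.mul hAm
  have hB1 : Measurable fun v : V3 => ‖v‖ₑ * B v := measurable_enorm.mul hBm
  set H : V3 × V3 → ℝ≥0∞ := fun p => ‖p.1‖ₑ * A p.1 * B p.2 + A p.1 * (‖p.2‖ₑ * B p.2) with hH
  have hH1 : Measurable fun p : V3 × V3 => ‖p.1‖ₑ * A p.1 * B p.2 :=
    (hA1.comp measurable_fst).mul (hBm.comp measurable_snd)
  have hH2 : Measurable fun p : V3 × V3 => A p.1 * (‖p.2‖ₑ * B p.2) :=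
    (hAm.comp measurable_fst).mul (hB1.comp measurable_snd)
  have hHm : Measurable H := hH1.add hH2
  have hpt : ∀ q : CollSpace, ENNReal.ofReal (collisionDensity q) * (a q.1.1 * b q.1.2) ≤ H q.1 := by
    intro q
    calc ENNReal.ofReal (collisionDensity q) * (a q.1.1 * b q.1.2)
        ≤ (‖q.1.1‖ₑ + ‖q.1.2‖ₑ) *
            (ENNReal.ofReal (globalMaxwellian q.1.1) * ENNReal.ofReal (globalMaxwellian q.1.2)) *
            (a q.1.1 * b q.1.2) := by
          gcongr
          exact CutProduction.ofReal_collisionDensity_le q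
      _ = H q.1 := by
          simp only [hH, hA, hB]
          ring
  calc ∫⁻ q, ENNReal.ofReal (collisionDensity q) * (a q.1.1 * b q.1.2) ∂collMeasure
      ≤ ∫⁻ q, H q.1 ∂collMeasure := lintegral_mono hpt
    _ = ∫⁻ p, ∫⁻ _ω, H p ∂sphereMeasure ∂((volume : Measure V3).prod volume) := by
        unfold collMeasure
        exact lintegral_prod _ (hHm.comp measurable_fst).aemeasurable
    _ = ∫⁻ p, H p * sphereMeasure (Set.univ : Set (Metric.sphere (0 : V3) 1))
          ∂((volume : Measure V3).prod volume) := by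
        simp_rw [lintegral_const]
    _ = (∫⁻ p, H p ∂((volume : Measure V3).prod volume)) *
          sphereMeasure (Set.univ : Set (Metric.sphere (0 : V3) 1)) := lintegral_mul_const _ hHm
    _ = ((∫⁻ v, ‖v‖ₑ * A v) * (∫⁻ v, B v) + (∫⁻ v, A v) * ∫⁻ v, ‖v‖ₑ * B v) *
          sphereMeasure (Set.univ : Set (Metric.sphere (0 : V3) 1)) := by
        rw [lintegral_add_left hH1, lintegral_prod_mul hA1.aemeasurable hBm.aemeasurable,
          lintegral_prod_mul hAm.aemeasurable hB1.aemeasurable]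
    _ = _ := by ring

/-- **Asymmetric loss bound, Gaussian form**:
`∫ B M M_* a(v) b(v_*) ≤ |S²| [(∫ ‖w‖ a dγ)(∫ b dγ) + (∫ a dγ)(∫ ‖w‖ b dγ)]`. -/
theorem lintegral_loss_le₂_gauss {a b : V3 → ℝ≥0∞} (ha : Measurable a) (hb : Measurable b) :
    ∫⁻ q, ENNReal.ofReal (collisionDensity q) * (a q.1.1 * b q.1.2) ∂collMeasure ≤
      sphereMeasure (Set.univ : Set (Metric.sphere (0 : V3) 1)) *
        ((∫⁻ w, ‖w‖ₑ * a w ∂stdGaussian V3) * (∫⁻ w, b w ∂stdGaussian V3) +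
          (∫⁻ w, a w ∂stdGaussian V3) * ∫⁻ w, ‖w‖ₑ * b w ∂stdGaussian V3) := by
  have hMm : Measurable fun v : V3 => ENNReal.ofReal (globalMaxwellian v) :=
    continuous_globalMaxwellian.measurable.ennreal_ofReal
  have h0 : ∀ {g : V3 → ℝ≥0∞}, Measurable g →
      ∫⁻ w, g w ∂stdGaussian V3 = ∫⁻ v, ENNReal.ofReal (globalMaxwellian v) * g v := by
    intro g hg
    rw [stdGaussian_eq_withDensity_globalMaxwellian_holds, lintegral_withDensity_eq_lintegral_mul _ hMm hg]
    rfl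
  have h1 : ∀ {g : V3 → ℝ≥0∞}, Measurable g →
      ∫⁻ w, ‖w‖ₑ * g w ∂stdGaussian V3 = ∫⁻ v, ‖v‖ₑ * (ENNReal.ofReal (globalMaxwellian v) * g v) := by
    intro g hg
    rw [h0 (g := fun w => ‖w‖ₑ * g w) (measurable_enorm.mul hg)]
    refine lintegral_congr fun v => ?_
    ring
  rw [h0 ha, h0 hb, h1 ha, h1 hb]
  exact lintegral_loss_le₂ ha hb

/-! ### The fibre bound -/

/-- The centred Hellinger fluctuation `ζ² = (√r - c)²` of the velocity density `r = (g ·).toReal` (as an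
`ℝ≥0∞`-valued function of the velocity) is measurable. -/
theorem measurable_zetaSq {g : V3 → ℝ≥0∞} (hg : Measurable g) (c : ℝ) :
    Measurable fun w => ENNReal.ofReal ((Real.sqrt (g w).toReal - c) ^ 2) :=
  ((hg.ennreal_toReal.sqrt.sub_const c).pow_const 2).ennreal_ofReal

/-- The centred loss integrand `(√r(v) √r(v_*) - c²)²` (as an `ℝ≥0∞`-valued function on collision space) is
measurable. -/
theorem measurable_lossSq {g : V3 → ℝ≥0∞} (hg : Measurable g) (c : ℝ) :
    Measurable fun q : CollSpace =>
      ENNReal.ofReal ((Real.sqrt (g q.1.1).toReal * Real.sqrt (g q.1.2).toReal - c ^ 2) ^ 2) := by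
  have h1 : Measurable fun q : CollSpace => Real.sqrt (g q.1.1).toReal :=
    (hg.comp measurable_fst.fst).ennreal_toReal.sqrt
  have h2 : Measurable fun q : CollSpace => Real.sqrt (g q.1.2).toReal :=
    (hg.comp measurable_fst.snd).ennreal_toReal.sqrt
  exact (((h1.mul h2).sub_const _).pow_const 2).ennreal_ofReal

/-- Pointwise: `B Ξ² ≤ 2 B (√(r'r'_*) - c²)² + 2 B (√(r r_*) - c²)²` (`(a - b)² ≤ 2a² + 2b²`), the first
term being the second composed with the collision involution `(v, v_*, ω) ↦ (v', v_*', -ω)`. -/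
theorem integrand_le_two (g : V3 → ℝ≥0∞) (c : ℝ) (q : CollSpace) :
    ENNReal.ofReal (collisionDensity q * hellingerDefect (fun w => (g w).toReal) q ^ 2) ≤
      2 * (ENNReal.ofReal (collisionDensity q) *
        ENNReal.ofReal ((Real.sqrt (g (collide q.2 q.1).1).toReal *
          Real.sqrt (g (collide q.2 q.1).2).toReal - c ^ 2) ^ 2)) +
        2 * (ENNReal.ofReal (collisionDensity q) *
          ENNReal.ofReal ((Real.sqrt (g q.1.1).toReal * Real.sqrt (g q.1.2).toReal - c ^ 2) ^ 2)) := by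
  have hΞ : hellingerDefect (fun w => (g w).toReal) q =
      (Real.sqrt (g (collide q.2 q.1).1).toReal * Real.sqrt (g (collide q.2 q.1).2).toReal - c ^ 2) -
        (Real.sqrt (g q.1.1).toReal * Real.sqrt (g q.1.2).toReal - c ^ 2) := by
    simp only [hellingerDefect]
    ring
  have h0 := collisionDensity_nonneg q
  calc ENNReal.ofReal (collisionDensity q * hellingerDefect (fun w => (g w).toReal) q ^ 2)
      ≤ ENNReal.ofReal (collisionDensity q *
          (2 * (Real.sqrt (g (collide q.2 q.1).1).toReal * Real.sqrt (g (collide q.2 q.1).2).toReal -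
              c ^ 2) ^ 2 +
            2 * (Real.sqrt (g q.1.1).toReal * Real.sqrt (g q.1.2).toReal - c ^ 2) ^ 2)) := by
        refine ENNReal.ofReal_le_ofReal (mul_le_mul_of_nonneg_left ?_ h0)
        have h2 : ∀ a b : ℝ, (a - b) ^ 2 ≤ 2 * a ^ 2 + 2 * b ^ 2 := fun a b => by
          nlinarith [sq_nonneg (a + b)]
        rw [hΞ]
        exact h2 _ _
    _ = _ := by
        rw [ENNReal.ofReal_mul h0, ENNReal.ofReal_add (by positivity) (by positivity),
          ENNReal.ofReal_mul zero_le_two, ENNReal.ofReal_mul zero_le_two, ENNReal.ofReal_ofNat]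
        ring

/-- Pointwise: `(√(r r_*) - c²)² ≤ 2 ζ(v)² r(v_*) + 2 c² ζ(v_*)²` in `ℝ≥0∞` (`ofReal r ≤ g`). -/
theorem lossSq_le (g : V3 → ℝ≥0∞) (c : ℝ) (q : CollSpace) :
    ENNReal.ofReal ((Real.sqrt (g q.1.1).toReal * Real.sqrt (g q.1.2).toReal - c ^ 2) ^ 2) ≤
      2 * (ENNReal.ofReal ((Real.sqrt (g q.1.1).toReal - c) ^ 2) * g q.1.2) +
        2 * (ENNReal.ofReal (c ^ 2) * ENNReal.ofReal ((Real.sqrt (g q.1.2).toReal - c) ^ 2)) := by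
  have h := sq_sqrt_mul_sqrt_sub_sq_le (g q.1.1).toReal (ENNReal.toReal_nonneg (a := g q.1.2)) c
  calc ENNReal.ofReal ((Real.sqrt (g q.1.1).toReal * Real.sqrt (g q.1.2).toReal - c ^ 2) ^ 2)
      ≤ ENNReal.ofReal (2 * ((Real.sqrt (g q.1.1).toReal - c) ^ 2 * (g q.1.2).toReal) +
          2 * (c ^ 2 * (Real.sqrt (g q.1.2).toReal - c) ^ 2)) := ENNReal.ofReal_le_ofReal h
    _ = 2 * (ENNReal.ofReal ((Real.sqrt (g q.1.1).toReal - c) ^ 2) * ENNReal.ofReal (g q.1.2).toReal) +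
          2 * (ENNReal.ofReal (c ^ 2) * ENNReal.ofReal ((Real.sqrt (g q.1.2).toReal - c) ^ 2)) := by
        rw [ENNReal.ofReal_add (by positivity) (by positivity), ENNReal.ofReal_mul zero_le_two,
          ENNReal.ofReal_mul zero_le_two, ENNReal.ofReal_mul (sq_nonneg _), ENNReal.ofReal_mul (sq_nonneg _),
          ENNReal.ofReal_ofNat]
    _ ≤ _ := by
        gcongr
        exact ENNReal.ofReal_toReal_le

/-- **Fibre bound.** For a measurable velocity density `g ≥ 0` (w.r.t. `γ`, `ℝ≥0∞`-valued) and a centring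
constant `c ≥ 0`, with `ζ = √g - c`:
`∫ B M M_* Ξ(g)² dλ ≤ 8 |S²| [(∫ g dγ + c²) ∫ ‖w‖ ζ² dγ + (∫ ζ² dγ)(∫ ‖w‖ g dγ + c² ∫ ‖w‖ dγ)]`
(`Ξ² ≤ 2 L∘J + 2 L` with `L = (√(g g_*) - c²)²` and `J` the collision involution, `∫ B L∘J = ∫ B L`,
`L ≤ 2 ζ² g_* + 2 c² ζ_*²`, and the asymmetric loss bound twice). -/
theorem fibre_le {g : V3 → ℝ≥0∞} (hg : Measurable g) (c : ℝ) :
    ∫⁻ q, ENNReal.ofReal (collisionDensity q * hellingerDefect (fun w => (g w).toReal) q ^ 2) ∂collMeasure ≤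
      8 * sphereMeasure (Set.univ : Set (Metric.sphere (0 : V3) 1)) *
        (((∫⁻ w, g w ∂stdGaussian V3) + ENNReal.ofReal (c ^ 2)) *
            (∫⁻ w, ‖w‖ₑ * ENNReal.ofReal ((Real.sqrt (g w).toReal - c) ^ 2) ∂stdGaussian V3) +
          (∫⁻ w, ENNReal.ofReal ((Real.sqrt (g w).toReal - c) ^ 2) ∂stdGaussian V3) *
            ((∫⁻ w, ‖w‖ₑ * g w ∂stdGaussian V3) +
              ENNReal.ofReal (c ^ 2) * ∫⁻ w, ‖w‖ₑ ∂stdGaussian V3)) := by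
  set γ : Measure V3 := stdGaussian V3 with hγ
  set s₂ : ℝ≥0∞ := sphereMeasure (Set.univ : Set (Metric.sphere (0 : V3) 1)) with hs₂
  -- local abbreviations (no new definitions): `Z = ζ²`, `L = (√(g g_*) - c²)²`
  set Z : V3 → ℝ≥0∞ := fun w => ENNReal.ofReal ((Real.sqrt (g w).toReal - c) ^ 2) with hZ
  set L : CollSpace → ℝ≥0∞ := fun q =>
    ENNReal.ofReal ((Real.sqrt (g q.1.1).toReal * Real.sqrt (g q.1.2).toReal - c ^ 2) ^ 2) with hL
  have hZm : Measurable Z := measurable_zetaSq hg c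
  have hLm : Measurable L := measurable_lossSq hg c
  have hBm : Measurable fun q : CollSpace => ENNReal.ofReal (collisionDensity q) :=
    measurable_collisionDensity.ennreal_ofReal
  have hinv : ∫⁻ q, ENNReal.ofReal (collisionDensity q) * L (collide q.2 q.1, -q.2) ∂collMeasure =
      ∫⁻ q, ENNReal.ofReal (collisionDensity q) * L q ∂collMeasure :=
    lintegral_collisionDensity_mul_comp_collide_negDir (E := V3) L
  -- the two loss integrals
  have hZg : Measurable fun q : CollSpace => ENNReal.ofReal (collisionDensity q) * (Z q.1.1 * g q.1.2) :=
    hBm.mul ((hZm.comp measurable_fst.fst).mul (hg.comp measurable_fst.snd))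
  have h1Z : Measurable fun q : CollSpace => ENNReal.ofReal (collisionDensity q) * Z q.1.2 :=
    hBm.mul (hZm.comp measurable_fst.snd)
  have h2m : Measurable fun q : CollSpace => 2 * (ENNReal.ofReal (collisionDensity q) * L q) :=
    (hBm.mul hLm).const_mul _
  have hloss₁ : ∫⁻ q, ENNReal.ofReal (collisionDensity q) * (Z q.1.1 * g q.1.2) ∂collMeasure ≤
      s₂ * ((∫⁻ w, ‖w‖ₑ * Z w ∂γ) * (∫⁻ w, g w ∂γ) + (∫⁻ w, Z w ∂γ) * ∫⁻ w, ‖w‖ₑ * g w ∂γ) :=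
    lintegral_loss_le₂_gauss hZm hg
  have hloss₂ : ∫⁻ q, ENNReal.ofReal (collisionDensity q) * Z q.1.2 ∂collMeasure ≤
      s₂ * ((∫⁻ w, ‖w‖ₑ ∂γ) * (∫⁻ w, Z w ∂γ) + ∫⁻ w, ‖w‖ₑ * Z w ∂γ) := by
    have h := lintegral_loss_le₂_gauss (measurable_const (a := (1 : ℝ≥0∞))) hZm
    simp only [mul_one, lintegral_const, measure_univ, one_mul] at h
    exact h
  calc ∫⁻ q, ENNReal.ofReal (collisionDensity q * hellingerDefect (fun w => (g w).toReal) q ^ 2) ∂collMeasure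
      ≤ ∫⁻ q, (2 * (ENNReal.ofReal (collisionDensity q) * L (collide q.2 q.1, -q.2)) +
          2 * (ENNReal.ofReal (collisionDensity q) * L q)) ∂collMeasure :=
        lintegral_mono (integrand_le_two g c)
    _ = 4 * ∫⁻ q, ENNReal.ofReal (collisionDensity q) * L q ∂collMeasure := by
        rw [lintegral_add_right _ h2m, lintegral_const_mul' _ _ ENNReal.ofNat_ne_top,
          lintegral_const_mul' _ _ ENNReal.ofNat_ne_top, hinv]
        ring
    _ ≤ 4 * ∫⁻ q, (2 * (ENNReal.ofReal (collisionDensity q) * (Z q.1.1 * g q.1.2)) +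
          2 * (ENNReal.ofReal (c ^ 2) * (ENNReal.ofReal (collisionDensity q) * Z q.1.2))) ∂collMeasure := by
        gcongr with q
        calc ENNReal.ofReal (collisionDensity q) * L q
            ≤ ENNReal.ofReal (collisionDensity q) *
                (2 * (Z q.1.1 * g q.1.2) + 2 * (ENNReal.ofReal (c ^ 2) * Z q.1.2)) := by
              gcongr
              exact lossSq_le g c q
          _ = _ := by ring
    _ = 4 * (2 * ∫⁻ q, ENNReal.ofReal (collisionDensity q) * (Z q.1.1 * g q.1.2) ∂collMeasure +
          2 * (ENNReal.ofReal (c ^ 2) * ∫⁻ q, ENNReal.ofReal (collisionDensity q) * Z q.1.2 ∂collMeasure)) := by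
        rw [lintegral_add_left (hZg.const_mul _), lintegral_const_mul _ hZg, lintegral_const_mul _ (h1Z.const_mul _),
          lintegral_const_mul _ h1Z]
    _ ≤ 4 * (2 * (s₂ * ((∫⁻ w, ‖w‖ₑ * Z w ∂γ) * (∫⁻ w, g w ∂γ) +
            (∫⁻ w, Z w ∂γ) * ∫⁻ w, ‖w‖ₑ * g w ∂γ)) +
          2 * (ENNReal.ofReal (c ^ 2) *
            (s₂ * ((∫⁻ w, ‖w‖ₑ ∂γ) * (∫⁻ w, Z w ∂γ) + ∫⁻ w, ‖w‖ₑ * Z w ∂γ)))) := by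
        gcongr
    _ = _ := by ring

/-! ### Truncation in the velocity -/

/-- Pointwise `ζ² ≤ g + c²` in `ℝ≥0∞` (`(√r - c)² ≤ r + c²` and `ofReal r ≤ g`). -/
theorem zetaSq_le (g : V3 → ℝ≥0∞) {c : ℝ} (hc : 0 ≤ c) (w : V3) :
    ENNReal.ofReal ((Real.sqrt (g w).toReal - c) ^ 2) ≤ g w + ENNReal.ofReal (c ^ 2) :=
  calc ENNReal.ofReal ((Real.sqrt (g w).toReal - c) ^ 2) ≤ ENNReal.ofReal ((g w).toReal + c ^ 2) :=
        ENNReal.ofReal_le_ofReal (sq_sqrt_sub_le ENNReal.toReal_nonneg hc)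
    _ = ENNReal.ofReal (g w).toReal + ENNReal.ofReal (c ^ 2) :=
        ENNReal.ofReal_add ENNReal.toReal_nonneg (sq_nonneg _)
    _ ≤ _ := by
        gcongr
        exact ENNReal.ofReal_toReal_le

/-- `∫ ζ² dγ ≤ ∫ g dγ + c²`. -/
theorem lintegral_zetaSq_le (g : V3 → ℝ≥0∞) {c : ℝ} (hc : 0 ≤ c) :
    ∫⁻ w, ENNReal.ofReal ((Real.sqrt (g w).toReal - c) ^ 2) ∂stdGaussian V3 ≤
      (∫⁻ w, g w ∂stdGaussian V3) + ENNReal.ofReal (c ^ 2) :=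
  calc ∫⁻ w, ENNReal.ofReal ((Real.sqrt (g w).toReal - c) ^ 2) ∂stdGaussian V3
      ≤ ∫⁻ w, (g w + ENNReal.ofReal (c ^ 2)) ∂stdGaussian V3 := lintegral_mono (zetaSq_le g hc)
    _ = _ := by rw [lintegral_add_right _ measurable_const, lintegral_const, measure_univ, mul_one]

/-- `∫ ‖w‖ g dγ ≤ R ∫ g dγ + R⁻¹ ∫ ‖w‖² g dγ` (`‖w‖ ≤ R + ‖w‖²/R`). -/
theorem lintegral_enorm_mul_le {g : V3 → ℝ≥0∞} (hg : Measurable g) {R : ℝ} (hR : 0 < R) :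
    ∫⁻ w, ‖w‖ₑ * g w ∂stdGaussian V3 ≤
      ENNReal.ofReal R * (∫⁻ w, g w ∂stdGaussian V3) +
        ENNReal.ofReal R⁻¹ * ∫⁻ w, ‖w‖ₑ ^ 2 * g w ∂stdGaussian V3 := by
  have hpt : ∀ w : V3, ‖w‖ₑ * g w ≤ ENNReal.ofReal R * g w + ENNReal.ofReal R⁻¹ * (‖w‖ₑ ^ 2 * g w) := by
    intro w
    have h1 : ‖w‖ₑ ≤ ENNReal.ofReal R + ENNReal.ofReal R⁻¹ * ‖w‖ₑ ^ 2 := by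
      calc ‖w‖ₑ = ENNReal.ofReal ‖w‖ := (ofReal_norm w).symm
        _ ≤ ENNReal.ofReal (R + R⁻¹ * ‖w‖ ^ 2) :=
            ENNReal.ofReal_le_ofReal (by rw [← div_eq_inv_mul]; exact le_add_sq_div ‖w‖ hR)
        _ = _ := by
            rw [ENNReal.ofReal_add hR.le (by positivity), ENNReal.ofReal_mul (inv_nonneg.2 hR.le),
              ENNReal.ofReal_pow (norm_nonneg _), ofReal_norm]
    calc ‖w‖ₑ * g w ≤ (ENNReal.ofReal R + ENNReal.ofReal R⁻¹ * ‖w‖ₑ ^ 2) * g w := mul_le_mul' h1 le_rfl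
      _ = _ := by ring
  have hm2 : Measurable fun w : V3 => ‖w‖ₑ ^ 2 * g w := (measurable_enorm.pow_const _).mul hg
  calc ∫⁻ w, ‖w‖ₑ * g w ∂stdGaussian V3
      ≤ ∫⁻ w, (ENNReal.ofReal R * g w + ENNReal.ofReal R⁻¹ * (‖w‖ₑ ^ 2 * g w)) ∂stdGaussian V3 :=
        lintegral_mono hpt
    _ = _ := by
        rw [lintegral_add_left (hg.const_mul _), lintegral_const_mul _ hg, lintegral_const_mul _ hm2]

/-- `∫ ‖w‖ ζ² dγ ≤ R ∫ ζ² dγ + R⁻¹ (∫ ‖w‖² g dγ + c² ∫ ‖w‖² dγ)` (the previous bound for `ζ²`, then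
`ζ² ≤ g + c²` in the second-moment term). -/
theorem lintegral_enorm_mul_zetaSq_le {g : V3 → ℝ≥0∞} (hg : Measurable g) {c : ℝ} (hc : 0 ≤ c) {R : ℝ}
    (hR : 0 < R) :
    ∫⁻ w, ‖w‖ₑ * ENNReal.ofReal ((Real.sqrt (g w).toReal - c) ^ 2) ∂stdGaussian V3 ≤
      ENNReal.ofReal R * (∫⁻ w, ENNReal.ofReal ((Real.sqrt (g w).toReal - c) ^ 2) ∂stdGaussian V3) +
        ENNReal.ofReal R⁻¹ * ((∫⁻ w, ‖w‖ₑ ^ 2 * g w ∂stdGaussian V3) +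
          ENNReal.ofReal (c ^ 2) * ∫⁻ w, ‖w‖ₑ ^ 2 ∂stdGaussian V3) := by
  have hm2 : Measurable fun w : V3 => ‖w‖ₑ ^ 2 * g w := (measurable_enorm.pow_const _).mul hg
  refine (lintegral_enorm_mul_le (measurable_zetaSq hg c) hR).trans ?_
  gcongr ENNReal.ofReal R * _ + ENNReal.ofReal R⁻¹ * ?_
  calc ∫⁻ w, ‖w‖ₑ ^ 2 * ENNReal.ofReal ((Real.sqrt (g w).toReal - c) ^ 2) ∂stdGaussian V3
      ≤ ∫⁻ w, (‖w‖ₑ ^ 2 * g w + ENNReal.ofReal (c ^ 2) * ‖w‖ₑ ^ 2) ∂stdGaussian V3 :=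
        lintegral_mono fun w => by
          calc ‖w‖ₑ ^ 2 * ENNReal.ofReal ((Real.sqrt (g w).toReal - c) ^ 2)
              ≤ ‖w‖ₑ ^ 2 * (g w + ENNReal.ofReal (c ^ 2)) := mul_le_mul' le_rfl (zetaSq_le g hc w)
            _ = _ := by ring
    _ = _ := by rw [lintegral_add_left hm2, lintegral_const_mul _ (measurable_enorm.pow_const _)]

end CutProductionContinuity

/-! ### The registered helper stub: the kept-fibre bound -/

/-- Statement of the helper stub `stub_productionContinuityPrelim` — **the kept-fibre bound**: for measurable `g`,
`c ≥ 0`, `R > 0` and a level `K` with `∫ g dγ ≤ K`, `c² ≤ K` (on a kept fibre `c² = n = ∫ g dγ ≤ K`),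
`∫ B M M_* Ξ(g)² ≤ 8 |S²| K [(3R + ∫ ‖w‖ dγ) ∫ (√g - c)² dγ + R⁻¹ (4 ∫ ‖w‖² g dγ + 2 K ∫ ‖w‖² dγ)]`. -/
def ProductionContinuityPrelim : Prop :=
  ∀ (g : V3 → ℝ≥0∞) (c R : ℝ) (K : ℝ≥0∞), Measurable g → 0 ≤ c → 0 < R →
    ∫⁻ w, g w ∂stdGaussian V3 ≤ K → ENNReal.ofReal (c ^ 2) ≤ K →
    ∫⁻ q, ENNReal.ofReal (collisionDensity q * hellingerDefect (fun w => (g w).toReal) q ^ 2) ∂collMeasure ≤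
      8 * sphereMeasure (Set.univ : Set (Metric.sphere (0 : V3) 1)) *
        (K * ((3 * ENNReal.ofReal R + ∫⁻ w, ‖w‖ₑ ∂stdGaussian V3) *
            (∫⁻ w, ENNReal.ofReal ((Real.sqrt (g w).toReal - c) ^ 2) ∂stdGaussian V3) +
          ENNReal.ofReal R⁻¹ * (4 * (∫⁻ w, ‖w‖ₑ ^ 2 * g w ∂stdGaussian V3) +
            2 * (K * ∫⁻ w, ‖w‖ₑ ^ 2 ∂stdGaussian V3))))

open CutProductionContinuity in
/-- **Helper stub `stub_productionContinuityPrelim`** (file 1 of 2): `fibre_le`, `∫ ζ² ≤ 2K`, the truncations. -/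
theorem stub_productionContinuityPrelim : ProductionContinuityPrelim := by
  intro g c R K hg hc hR hN hcK
  set γ : Measure V3 := stdGaussian V3
  set N := ∫⁻ w, g w ∂γ
  set H := ∫⁻ w, ENNReal.ofReal ((Real.sqrt (g w).toReal - c) ^ 2) ∂γ
  set W := ∫⁻ w, ‖w‖ₑ * ENNReal.ofReal ((Real.sqrt (g w).toReal - c) ^ 2) ∂γ
  set M1 := ∫⁻ w, ‖w‖ₑ * g w ∂γ
  set M2 := ∫⁻ w, ‖w‖ₑ ^ 2 * g w ∂γ
  set mγ := ∫⁻ w, ‖w‖ₑ ∂γ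
  set m2γ := ∫⁻ w, ‖w‖ₑ ^ 2 ∂γ
  have hH : H ≤ K + K := (lintegral_zetaSq_le g hc).trans (add_le_add hN hcK)
  have hW : W ≤ ENNReal.ofReal R * H + ENNReal.ofReal R⁻¹ * (M2 + K * m2γ) :=
    (lintegral_enorm_mul_zetaSq_le hg hc hR).trans (by gcongr)
  have hM1 : M1 ≤ ENNReal.ofReal R * K + ENNReal.ofReal R⁻¹ * M2 :=
    (lintegral_enorm_mul_le hg hR).trans (by gcongr)
  calc ∫⁻ q, ENNReal.ofReal (collisionDensity q * hellingerDefect (fun w => (g w).toReal) q ^ 2) ∂collMeasure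
      ≤ 8 * sphereMeasure (Set.univ : Set (Metric.sphere (0 : V3) 1)) *
          ((N + ENNReal.ofReal (c ^ 2)) * W + H * (M1 + ENNReal.ofReal (c ^ 2) * mγ)) := fibre_le hg c
    _ ≤ 8 * sphereMeasure (Set.univ : Set (Metric.sphere (0 : V3) 1)) *
          ((K + K) * (ENNReal.ofReal R * H + ENNReal.ofReal R⁻¹ * (M2 + K * m2γ)) +
            (H * (ENNReal.ofReal R * K + ENNReal.ofReal R⁻¹ * M2) + H * (K * mγ))) := by
        rw [mul_add H]
        gcongr
    _ = 8 * sphereMeasure (Set.univ : Set (Metric.sphere (0 : V3) 1)) *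
          (K * ((3 * ENNReal.ofReal R + mγ) * H + ENNReal.ofReal R⁻¹ * (2 * M2 + 2 * (K * m2γ))) +
            ENNReal.ofReal R⁻¹ * (H * M2)) := by ring
    _ ≤ 8 * sphereMeasure (Set.univ : Set (Metric.sphere (0 : V3) 1)) *
          (K * ((3 * ENNReal.ofReal R + mγ) * H + ENNReal.ofReal R⁻¹ * (2 * M2 + 2 * (K * m2γ))) +
            ENNReal.ofReal R⁻¹ * ((K + K) * M2)) := by gcongr
    _ = _ := by ring

end Summit.AtomisticToContinuum.HydrodynamicLimit.Theorems.HTheorem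

end
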